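import Mathlib.NumberTheory.Transcendental.Liouville.Basic
import Mathlib.NumberTheory.Real.Irrational
import Mathlib.RingTheory.Polynomial.GaussLemma
import Summits.Parity.BatemanHorn.Theorems.SoloInformedPolynomialGrowth

/-!
# SoloInformedPowerValues — `d`-th power values of an irreducible integer polynomial of degree `d`

Solo unit `solo-Parity-informed` (ideation tier, informed mode), session 14; `PLAN.md` §22.5(b), CLAIMS C60.

For `g ∈ ℤ[X]` with `d = deg g ≥ 2` and leading coefficient `a > 0`, write `b = coeff_{d-1} g`,
`β = b/(da)`, `α = a^{1/d}`.  Then `g(n) = a (n + β)^d + O(n^{d-2})`, so a `d`-th power value `|g(n)| = m^d`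
forces `|m - α (n + β)| ≤ C/n` (`exists_abs_sub_rootLead_mul_le`).  Consequences:

* `exists_finset_of_leadingCoeff_eq_pow` — if `a = A^d` is a `d`-th power (`g` irreducible), the `n` with
  `|g(n)|` a `d`-th power form a FINITE set (for large `n` the approximation is an equality `m = A(n+β)`, i.e.
  `(da)^d g(n) = a (dan + b)^d`, a non-trivial polynomial identity since `g` has no rational root);
* `exists_spacing_of_leadingCoeff_ne_pow` — otherwise `α` is an irrational algebraic number of degree `≤ d` and
  Liouville's inequality (Mathlib's `Liouville.exists_pos_real_of_irrational_root`) spaces the solutions: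
  two solutions `n₁ ≤ n < n'` satisfy `n ≤ K (n' - n)^{d-1}`.

The counting consequence (`o(x/log x)` such `n ≤ x`) is in `SoloInformedPowerValuesCount`.  Elementary; this is
the exponent `k = d` of the proper-prime-power hypothesis `hPP` of `SoloInformedPolynomialPrimeCount` (§22.5).
-/

namespace Summit.Parity.BatemanHorn.Theorems

open Finset Filter Polynomial
open scoped Topology

/-! ### The two-term expansion `g(n) = a (n + β)^d + O(n^{d-2})` -/

/-- `β_g = b/(da)`. -/
noncomputable def rootShift (g : ℤ[X]) : ℝ :=
  (g.coeff (g.natDegree - 1) : ℝ) / ((g.natDegree : ℝ) * (g.leadingCoeff : ℝ))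

/-- `α_g = a^{1/d}`. -/
noncomputable def rootLead (g : ℤ[X]) : ℝ := (g.leadingCoeff : ℝ) ^ ((g.natDegree : ℝ)⁻¹)

/-- `α_g > 0` when `a > 0`. -/
theorem rootLead_pos {g : ℤ[X]} (hlc : 0 < g.leadingCoeff) : 0 < rootLead g :=
  Real.rpow_pos_of_pos (by exact_mod_cast hlc) _

/-- `α_g ^ d = a`. -/
theorem rootLead_pow {g : ℤ[X]} (hlc : 0 < g.leadingCoeff) (hdeg : g.natDegree ≠ 0) :
    rootLead g ^ g.natDegree = (g.leadingCoeff : ℝ) :=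
  Real.rpow_inv_natCast_pow (by exact_mod_cast hlc.le) hdeg

/-- `|p(x)| ≤ (∑_{i ≤ m} |p_i|) x^m` for `x ≥ 1` and `deg p ≤ m`. -/
theorem abs_eval_le_sum_abs_coeff_mul_pow (p : ℝ[X]) {x : ℝ} (hx : 1 ≤ x) {m : ℕ} (hm : p.natDegree ≤ m) :
    |p.eval x| ≤ (∑ i ∈ range (m + 1), |p.coeff i|) * x ^ m := by
  rw [eval_eq_sum_range' (Nat.lt_succ_of_le hm), sum_mul]
  refine (abs_sum_le_sum_abs _ _).trans (sum_le_sum fun i hi => ?_)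
  rw [mem_range] at hi
  rw [abs_mul, abs_of_nonneg (pow_nonneg (zero_le_one.trans hx) i)]
  exact mul_le_mul_of_nonneg_left (pow_le_pow_right₀ hx (by omega)) (abs_nonneg _)

/-- **Two-term expansion**: `|g(n) - a (n + β)^d| ≤ C₁ n^{d-2}` for every `n ≥ 1`. -/
theorem exists_abs_eval_sub_lead_mul_add_pow_le {g : ℤ[X]} (hdeg : 2 ≤ g.natDegree)
    (hlc : g.leadingCoeff ≠ 0) :
    ∃ C₁ : ℝ, 0 ≤ C₁ ∧ ∀ n : ℕ, 1 ≤ n →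
      |((g.eval (n : ℤ) : ℤ) : ℝ) - (g.leadingCoeff : ℝ) * ((n : ℝ) + rootShift g) ^ g.natDegree|
        ≤ C₁ * (n : ℝ) ^ (g.natDegree - 2) := by
  set d := g.natDegree with hd
  set a : ℝ := (g.leadingCoeff : ℝ) with ha
  set β : ℝ := rootShift g with hβ
  set h : ℝ[X] := g.map (Int.castRingHom ℝ) - C a * (X + C β) ^ d with hh
  have ha0 : a ≠ 0 := by rw [ha]; exact_mod_cast hlc
  have hd0 : (d : ℝ) ≠ 0 := by
    have : d ≠ 0 := by omega
    exact_mod_cast this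
  -- `deg h ≤ d - 2`: the coefficients of `X^d` and `X^{d-1}` cancel.
  have hdeg_h : h.natDegree ≤ d - 2 := by
    rw [natDegree_le_iff_coeff_eq_zero]
    intro N hN
    rw [hh, coeff_sub, coeff_map, coeff_C_mul, coeff_X_add_C_pow, eq_intCast]
    rcases Nat.lt_or_ge d N with hdN | hdN
    · rw [coeff_eq_zero_of_natDegree_lt (by rw [← hd]; exact hdN), Nat.choose_eq_zero_of_lt hdN]
      simp
    · rcases hdN.eq_or_lt with hNd | hNd
      · -- `N = d`
        subst hNd
        rw [Nat.sub_self, pow_zero, Nat.choose_self, Nat.cast_one, one_mul, mul_one]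
        rw [show g.coeff g.natDegree = g.leadingCoeff from rfl]
        simp [ha]
      · -- `N = d - 1`
        obtain ⟨d', hd'⟩ : ∃ d', d = d' + 1 := ⟨d - 1, by omega⟩
        have hN1 : N = d' := by omega
        subst hN1
        rw [hd', Nat.add_sub_cancel_left, pow_one, Nat.choose_succ_self_right]
        have hcoef : (g.coeff N : ℝ) = β * ((d : ℝ) * a) := by
          rw [hβ, rootShift, ← hd, hd', Nat.add_sub_cancel, ← ha]
          rw [hd'] at hd0
          field_simp
        rw [hcoef, hd']
        push_cast
        ring
  refine ⟨∑ i ∈ range (d - 2 + 1), |h.coeff i|, sum_nonneg fun i _ => abs_nonneg _, fun n hn => ?_⟩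
  have hn' : (1 : ℝ) ≤ n := by exact_mod_cast hn
  have hev : h.eval (n : ℝ) = ((g.eval (n : ℤ) : ℤ) : ℝ) - a * ((n : ℝ) + β) ^ d := by
    rw [hh, eval_sub, eval_natCast_map_intCast]
    simp
  rw [← hev]
  exact abs_eval_le_sum_abs_coeff_mul_pow h hn' hdeg_h

/-! ### `d`-th power values are close to `α (n + β)` -/

/-- `|m - y| · y^{d-1} ≤ |m^d - y^d|` for `m ≥ 0`, `y > 0`, `d ≥ 1`. -/
theorem abs_sub_mul_pow_le_abs_pow_sub_pow {m y : ℝ} (hm : 0 ≤ m) (hy : 0 < y) {d : ℕ} (hd : 1 ≤ d) :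
    |m - y| * y ^ (d - 1) ≤ |m ^ d - y ^ d| := by
  have hgeom := (Commute.all m y).geom_sum₂_mul d
  have hsum_nonneg : 0 ≤ ∑ i ∈ range d, m ^ i * y ^ (d - 1 - i) :=
    sum_nonneg fun i _ => mul_nonneg (pow_nonneg hm _) (pow_nonneg hy.le _)
  have hterm : y ^ (d - 1) ≤ ∑ i ∈ range d, m ^ i * y ^ (d - 1 - i) := by
    have h0 : (0 : ℕ) ∈ range d := mem_range.mpr (by omega)
    refine le_trans ?_ (single_le_sum (fun i _ => mul_nonneg (pow_nonneg hm _) (pow_nonneg hy.le _)) h0)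
    simp
  calc |m - y| * y ^ (d - 1)
      ≤ |m - y| * ∑ i ∈ range d, m ^ i * y ^ (d - 1 - i) :=
        mul_le_mul_of_nonneg_left hterm (abs_nonneg _)
    _ = |m ^ d - y ^ d| := by
        rw [← hgeom, abs_mul, abs_of_nonneg hsum_nonneg, mul_comm]

/-- **A `d`-th power value `|g(n)| = m^d` forces `|m - α (n + β)| ≤ C/n`** (`n ≥ n₁`). -/
theorem exists_abs_sub_rootLead_mul_le {g : ℤ[X]} (hdeg : 2 ≤ g.natDegree) (hlc : 0 < g.leadingCoeff) :
    ∃ n₁ : ℕ, 1 ≤ n₁ ∧ ∃ C : ℝ, 0 < C ∧ ∀ n : ℕ, n₁ ≤ n → ∀ m : ℕ,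
      (g.eval (n : ℤ)).natAbs = m ^ g.natDegree →
        |(m : ℝ) - rootLead g * ((n : ℝ) + rootShift g)| ≤ C / n := by
  set d := g.natDegree with hd
  set a : ℝ := (g.leadingCoeff : ℝ) with ha
  set β : ℝ := rootShift g with hβ
  set α : ℝ := rootLead g with hα
  have hα0 : 0 < α := rootLead_pos hlc
  have hαd : α ^ d = a := rootLead_pow hlc (by omega)
  obtain ⟨n₀, hn₀⟩ := exists_eval_natCast_pos (show 0 < g.natDegree by omega) hlc
  obtain ⟨C₁, hC₁0, hC₁⟩ := exists_abs_eval_sub_lead_mul_add_pow_le hdeg hlc.ne'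
  refine ⟨max (max n₀ 1) (⌈2 * |β|⌉₊ + 1), le_max_of_le_left (le_max_right _ _),
    (C₁ + 1) / (α / 2) ^ (d - 1), by positivity, fun n hn m hm => ?_⟩
  have hn0 : n₀ ≤ n := le_trans (le_max_left _ _) ((le_max_left _ _).trans hn)
  have hn1 : 1 ≤ n := le_trans (le_max_right _ _) ((le_max_left _ _).trans hn)
  have hn1' : (1 : ℝ) ≤ n := by exact_mod_cast hn1
  have hnpos : (0 : ℝ) < n := by linarith
  have hnβ : 2 * |β| ≤ (n : ℝ) := by
    have h1 : ⌈2 * |β|⌉₊ + 1 ≤ n := (le_max_right _ _).trans hn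
    have h2 : (2 * |β| : ℝ) ≤ ⌈2 * |β|⌉₊ := Nat.le_ceil _
    have h3 : ((⌈2 * |β|⌉₊ + 1 : ℕ) : ℝ) ≤ n := by exact_mod_cast h1
    push_cast at h3
    linarith
  -- `y = α (n + β) ≥ α n / 2 > 0`
  have hnβ' : (n : ℝ) / 2 ≤ (n : ℝ) + β := by
    have := neg_abs_le β
    linarith
  set y : ℝ := α * ((n : ℝ) + β) with hy
  have hy_lb : α / 2 * n ≤ y := by
    rw [hy]
    have := mul_le_mul_of_nonneg_left hnβ' hα0.le
    linarith
  have hy0 : 0 < y := lt_of_lt_of_le (by positivity) hy_lb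
  have hyd : y ^ d = a * ((n : ℝ) + β) ^ d := by rw [hy, mul_pow, hαd]
  -- `m^d = |g(n)| = g(n)`
  have hgpos : 0 < g.eval (n : ℤ) := hn₀ n hn0
  have hmd : ((m : ℝ)) ^ d = ((g.eval (n : ℤ) : ℤ) : ℝ) := by
    have h1 : ((g.eval (n : ℤ)).natAbs : ℤ) = g.eval (n : ℤ) := Int.natAbs_of_nonneg hgpos.le
    have h2 : ((m ^ d : ℕ) : ℤ) = g.eval (n : ℤ) := by rw [← hm]; exact h1
    have h3 : ((m : ℝ)) ^ d = (((m ^ d : ℕ) : ℤ) : ℝ) := by push_cast; ring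
    rw [h3, h2]
  have hclose : |(m : ℝ) ^ d - y ^ d| ≤ C₁ * (n : ℝ) ^ (d - 2) := by
    rw [hmd, hyd]
    exact hC₁ n hn1
  have hkey := abs_sub_mul_pow_le_abs_pow_sub_pow (Nat.cast_nonneg m) hy0 (show 1 ≤ d by omega)
  -- `|m - y| y^{d-1} ≤ C₁ n^{d-2}` and `y^{d-1} ≥ (α/2)^{d-1} n^{d-1}`
  have hyd1 : (α / 2) ^ (d - 1) * (n : ℝ) ^ (d - 1) ≤ y ^ (d - 1) := by
    rw [← mul_pow]
    exact pow_le_pow_left₀ (by positivity) hy_lb _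
  have hpow_pos : 0 < (α / 2) ^ (d - 1) * (n : ℝ) ^ (d - 1) := by positivity
  have h1 : |(m : ℝ) - y| * ((α / 2) ^ (d - 1) * (n : ℝ) ^ (d - 1)) ≤ C₁ * (n : ℝ) ^ (d - 2) :=
    le_trans (mul_le_mul_of_nonneg_left hyd1 (abs_nonneg _)) (hkey.trans hclose)
  rw [le_div_iff₀ hnpos]
  have hnd : (n : ℝ) ^ (d - 1) = (n : ℝ) ^ (d - 2) * n := by
    rw [← pow_succ]
    congr 1
    omega
  have h2 : |(m : ℝ) - y| * (α / 2) ^ (d - 1) * (n : ℝ) ^ (d - 2) * n ≤ C₁ * (n : ℝ) ^ (d - 2) := by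
    calc |(m : ℝ) - y| * (α / 2) ^ (d - 1) * (n : ℝ) ^ (d - 2) * n
        = |(m : ℝ) - y| * ((α / 2) ^ (d - 1) * (n : ℝ) ^ (d - 1)) := by rw [hnd]; ring
      _ ≤ C₁ * (n : ℝ) ^ (d - 2) := h1
  have hαpow : 0 < (α / 2) ^ (d - 1) := by positivity
  have hnpow : 0 < (n : ℝ) ^ (d - 2) := by positivity
  -- divide by `(α/2)^{d-1} n^{d-2}`
  have h3 : |(m : ℝ) - y| * n ≤ C₁ / (α / 2) ^ (d - 1) := by
    rw [le_div_iff₀ hαpow]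
    have h4 : |(m : ℝ) - y| * n * (α / 2) ^ (d - 1) * (n : ℝ) ^ (d - 2) ≤ C₁ * (n : ℝ) ^ (d - 2) := by
      calc |(m : ℝ) - y| * n * (α / 2) ^ (d - 1) * (n : ℝ) ^ (d - 2)
          = |(m : ℝ) - y| * (α / 2) ^ (d - 1) * (n : ℝ) ^ (d - 2) * n := by ring
        _ ≤ C₁ * (n : ℝ) ^ (d - 2) := h2
    exact le_of_mul_le_mul_right h4 hnpow
  calc |(m : ℝ) - y| * n ≤ C₁ / (α / 2) ^ (d - 1) := h3
    _ ≤ (C₁ + 1) / (α / 2) ^ (d - 1) := by gcongr; linarith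

/-! ### Leading coefficient a `d`-th power: finitely many `d`-th power values -/

/-- An irreducible `g ∈ ℤ[X]` of degree `≥ 2` has no rational root. -/
theorem not_isRoot_map_rat_of_irreducible {g : ℤ[X]} (hirr : Irreducible g) (hdeg : 2 ≤ g.natDegree)
    (r : ℚ) : ¬(g.map (Int.castRingHom ℚ)).IsRoot r := by
  intro hr
  have hprim : g.IsPrimitive := hirr.isPrimitive (by omega)
  have hirrQ : Irreducible (g.map (algebraMap ℤ ℚ)) :=
    (hprim.irreducible_iff_irreducible_map_fraction_map (K := ℚ)).mp hirr
  have h1 := degree_eq_one_of_irreducible_of_root hirrQ (by simpa using hr)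
  have h2 : (g.map (algebraMap ℤ ℚ)).natDegree = g.natDegree :=
    natDegree_map_eq_of_injective (algebraMap ℤ ℚ).injective_int _
  have h3 : (g.map (algebraMap ℤ ℚ)).natDegree = 1 := natDegree_eq_of_degree_eq_some h1
  omega

/-- **If `a = A^d`, the `n` with `|g(n)|` a `d`-th power form a finite set** (`g` irreducible, `deg g = d ≥ 2`). -/
theorem exists_finset_of_leadingCoeff_eq_pow {g : ℤ[X]} (hirr : Irreducible g) (hdeg : 2 ≤ g.natDegree)
    (hlc : 0 < g.leadingCoeff) {A : ℕ} (hA : g.leadingCoeff = (A : ℤ) ^ g.natDegree) :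
    ∃ T : Finset ℕ, ∀ n m : ℕ, (g.eval (n : ℤ)).natAbs = m ^ g.natDegree → n ∈ T := by
  set d := g.natDegree with hd
  set b : ℤ := g.coeff (d - 1) with hb
  obtain ⟨n₁, hn₁1, K, hK0, hK⟩ := exists_abs_sub_rootLead_mul_le hdeg hlc
  obtain ⟨n₀, hn₀⟩ := exists_eval_natCast_pos (show 0 < g.natDegree by omega) hlc
  have hd0 : d ≠ 0 := by omega
  have hA0 : 0 < A := by
    rcases Nat.eq_zero_or_pos A with h | h
    · rw [h, Nat.cast_zero, zero_pow hd0] at hA; rw [hA] at hlc; exact absurd hlc (lt_irrefl 0)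
    · exact h
  have hα : rootLead g = A := by
    rw [rootLead, hA]; push_cast
    exact Real.pow_rpow_inv_natCast (Nat.cast_nonneg A) hd0
  set a : ℤ := g.leadingCoeff with ha
  have hda0 : (d : ℤ) * a ≠ 0 := mul_ne_zero (by exact_mod_cast hd0) hlc.ne'
  -- `D = d A^{d-1}`, `D A = d a`; the integer polynomial `H = D^d g - (da X + b)^d`
  set D : ℕ := d * A ^ (d - 1) with hD
  have hD0 : 0 < D := by positivity
  have hDA : (D : ℤ) * A = d * a := by
    rw [hA, hD]; push_cast
    rw [mul_assoc, ← pow_succ, Nat.sub_add_cancel (by omega)]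
  set H : ℤ[X] := C ((D : ℤ) ^ d) * g - (C ((d : ℤ) * a) * X + C b) ^ d with hH
  have hH0 : H ≠ 0 := by
    intro hH0
    -- then `-b/(da)` is a rational root of `g`
    apply not_isRoot_map_rat_of_irreducible hirr hdeg (-(b : ℚ) / ((d : ℚ) * a))
    have h1 : H.eval₂ (Int.castRingHom ℚ) (-(b : ℚ) / ((d : ℚ) * a)) = 0 := by rw [hH0, eval₂_zero]
    rw [hH] at h1
    simp only [eval₂_sub, eval₂_mul, eval₂_C, eval₂_pow, eval₂_add, eval₂_X] at h1
    simp only [Int.coe_castRingHom, Int.cast_pow, Int.cast_mul, Int.cast_natCast] at h1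
    have hda0' : ((d : ℚ) * a) ≠ 0 := by exact_mod_cast hda0
    have h2 : (d : ℚ) * a * (-(b : ℚ) / ((d : ℚ) * a)) + b = 0 := by field_simp; ring
    rw [h2, zero_pow hd0, sub_zero] at h1
    rw [IsRoot.def, eval_map]
    have hD0' : ((D : ℚ)) ^ d ≠ 0 := pow_ne_zero _ (by exact_mod_cast hD0.ne')
    exact (mul_eq_zero.mp h1).resolve_left hD0'
  -- for `n > D C` a solution satisfies `D m = d a n + b`, hence `H(n) = 0`
  refine ⟨Icc 0 (max n₁ (max n₀ ⌈(D : ℝ) * K⌉₊)) ∪ (H.roots.toFinset.image Int.toNat),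
    fun n m hm => ?_⟩
  rw [mem_union]
  by_cases hn : n ≤ max n₁ (max n₀ ⌈(D : ℝ) * K⌉₊)
  · exact Or.inl (mem_Icc.mpr ⟨Nat.zero_le _, hn⟩)
  right
  push Not at hn
  have hn1 : n₁ ≤ n := ((le_max_left _ _).trans hn.le)
  have hnn0 : n₀ ≤ n := (le_max_left _ _).trans ((le_max_right _ _).trans hn.le)
  have hnC : (D : ℝ) * K < n := by
    have h1 : ⌈(D : ℝ) * K⌉₊ < n := lt_of_le_of_lt ((le_max_right _ _).trans (le_max_right _ _)) hn
    exact lt_of_le_of_lt (Nat.le_ceil _) (by exact_mod_cast h1)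
  have hnpos : (0 : ℝ) < n := lt_of_le_of_lt (by positivity) hnC
  have hclose := hK n hn1 m hm
  rw [hα] at hclose
  -- `|D m - (D A n + D A β)| ≤ D C / n < 1` with `D A β = b`
  have hDAβ : (D : ℝ) * A * rootShift g = b := by
    have h1 : ((D : ℤ) * A : ℤ) = (d * a : ℤ) := hDA
    have h2 : (D : ℝ) * A = d * a := by exact_mod_cast h1
    rw [h2, rootShift, ← hd, ← hb, ← ha]
    have : (d : ℝ) * (a : ℝ) ≠ 0 := by exact_mod_cast hda0
    field_simp
  have hint : ((D : ℤ) * m : ℤ) = (d * a * n + b : ℤ) := by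
    -- two integers at real distance `< 1` are equal
    suffices hlt : |((((D : ℤ) * m : ℤ)) : ℝ) - ((d * a * n + b : ℤ) : ℝ)| < 1 by
      have h1 : |(D : ℤ) * m - (d * a * n + b)| < 1 := by exact_mod_cast hlt
      rw [abs_lt] at h1
      omega
    have h1 : |((D : ℝ)) * ((m : ℝ) - A * ((n : ℝ) + rootShift g))| ≤ D * (K / n) := by
      rw [abs_mul, abs_of_nonneg (Nat.cast_nonneg D)]
      exact mul_le_mul_of_nonneg_left hclose (Nat.cast_nonneg D)
    have h2 : (D : ℝ) * (K / n) < 1 := by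
      rw [← mul_div_assoc, div_lt_one hnpos]; exact hnC
    have h3 : ((D : ℝ)) * ((m : ℝ) - A * ((n : ℝ) + rootShift g))
        = (((D : ℤ) * m : ℤ) : ℝ) - ((d * a * n + b : ℤ) : ℝ) := by
      have h4 : (d : ℝ) * a = D * A := by exact_mod_cast hDA.symm
      push_cast
      rw [h4]
      have := hDAβ
      linear_combination -this
    rw [← h3]
    exact lt_of_le_of_lt h1 h2
  -- hence `(da)^d g(n) = a (dan + b)^d`, i.e. `H(n) = 0`
  have hgpos : 0 < g.eval (n : ℤ) := hn₀ n hnn0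
  have hgn : g.eval (n : ℤ) = (m : ℤ) ^ d := by
    have h1 : ((g.eval (n : ℤ)).natAbs : ℤ) = g.eval (n : ℤ) := Int.natAbs_of_nonneg hgpos.le
    rw [← h1, hm]; push_cast; rfl
  have hHn : H.eval (n : ℤ) = 0 := by
    rw [hH]
    simp only [eval_sub, eval_mul, eval_C, eval_pow, eval_add, eval_X]
    rw [hgn, ← hint, ← mul_pow, sub_self]
  have hroot : (n : ℤ) ∈ H.roots := (mem_roots hH0).mpr (IsRoot.def.mpr hHn)
  exact mem_image.mpr ⟨(n : ℤ), Multiset.mem_toFinset.mpr hroot, by simp⟩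

/-! ### Leading coefficient not a `d`-th power: Liouville spacing -/

/-- If `a > 0` is not a `d`-th power (`d = deg g ≥ 2`), then `α = a^{1/d}` is irrational. -/
theorem irrational_rootLead {g : ℤ[X]} (hdeg : 2 ≤ g.natDegree) (hlc : 0 < g.leadingCoeff)
    (hA : ∀ A : ℕ, g.leadingCoeff ≠ (A : ℤ) ^ g.natDegree) : Irrational (rootLead g) := by
  have hd0 : g.natDegree ≠ 0 := by omega
  refine irrational_nrt_of_notint_nrt g.natDegree g.leadingCoeff ?_ ?_ (by omega)
  · rw [rootLead_pow hlc hd0]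
  · rintro ⟨y, hy⟩
    have hy0 : 0 ≤ y := by
      have : (0 : ℝ) < y := by rw [← hy]; exact rootLead_pos hlc
      exact_mod_cast this.le
    apply hA y.toNat
    have h1 : (rootLead g) ^ g.natDegree = (g.leadingCoeff : ℝ) := rootLead_pow hlc hd0
    rw [hy] at h1
    have h2 : ((y.toNat : ℤ) : ℝ) = (y : ℝ) := by exact_mod_cast Int.toNat_of_nonneg hy0
    have h3 : ((((y.toNat : ℕ) : ℤ) ^ g.natDegree : ℤ) : ℝ) = (g.leadingCoeff : ℝ) := by
      push_cast; rw [← h1, ← h2]; push_cast; ring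
    exact_mod_cast h3.symm

/-- **Liouville spacing**: if `a` is not a `d`-th power, two arguments `n₁ ≤ n < n'` at which `|g|` takes
`d`-th power values satisfy `n ≤ K (n' - n)^{d-1}`. -/
theorem exists_spacing_of_leadingCoeff_ne_pow {g : ℤ[X]} (hdeg : 2 ≤ g.natDegree) (hlc : 0 < g.leadingCoeff)
    (hA : ∀ A : ℕ, g.leadingCoeff ≠ (A : ℤ) ^ g.natDegree) :
    ∃ n₁ : ℕ, 1 ≤ n₁ ∧ ∃ K : ℝ, 0 < K ∧ ∀ n n' : ℕ, n₁ ≤ n → n < n' → ∀ m m' : ℕ,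
      (g.eval (n : ℤ)).natAbs = m ^ g.natDegree → (g.eval (n' : ℤ)).natAbs = m' ^ g.natDegree →
        (n : ℝ) ≤ K * ((n' : ℝ) - n) ^ (g.natDegree - 1) := by
  set d := g.natDegree with hd
  have hd0 : d ≠ 0 := by omega
  obtain ⟨n₁, hn₁1, C, hC0, hC⟩ := exists_abs_sub_rootLead_mul_le hdeg hlc
  set α := rootLead g with hα
  set β := rootShift g with hβ
  -- Liouville for `α`, a root of `X^d - a`
  have hirr : Irrational α := irrational_rootLead hdeg hlc hA
  set f : ℤ[X] := X ^ d - Polynomial.C g.leadingCoeff with hf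
  have hf0 : f ≠ 0 := X_pow_sub_C_ne_zero (by omega) _
  have hfd : f.natDegree = d := natDegree_X_pow_sub_C
  have hfa : eval α (map (algebraMap ℤ ℝ) f) = 0 := by
    rw [hf, Polynomial.map_sub, Polynomial.map_pow, map_X, map_C, eval_sub, eval_pow, eval_X, eval_C,
      hα, rootLead_pow hlc hd0]
    simp
  obtain ⟨A, hA0, hLiou⟩ := Liouville.exists_pos_real_of_irrational_root hirr hf0 hfa
  rw [hfd] at hLiou
  refine ⟨n₁, hn₁1, 2 * C * A, by positivity, fun n n' hn hnn' m m' hm hm' => ?_⟩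
  have hn1 : (1 : ℝ) ≤ n := by exact_mod_cast hn₁1.trans hn
  have hnpos : (0 : ℝ) < n := by linarith
  have hn'pos : (0 : ℝ) < n' := by exact_mod_cast lt_of_lt_of_le (hn₁1.trans hn) hnn'.le
  have e1 := hC n hn m hm
  have e2 := hC n' (hn.trans hnn'.le) m' hm'
  have e2' : |(m' : ℝ) - α * ((n' : ℝ) + β)| ≤ C / n :=
    e2.trans (div_le_div_of_nonneg_left hC0.le hnpos (by exact_mod_cast hnn'.le))
  -- `Q = n' - n ≥ 1`, `P = m' - m`: `|α Q - P| ≤ 2C/n`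
  set Q : ℕ := n' - n with hQ
  have hQ1 : 1 ≤ Q := by omega
  have hQr : (Q : ℝ) = (n' : ℝ) - n := by rw [hQ]; push_cast [hnn'.le]; ring
  have hQpos : (0 : ℝ) < Q := by exact_mod_cast hQ1
  have hαQ : |α * Q - ((m' : ℤ) - m : ℤ)| ≤ 2 * C / n := by
    have : α * Q - (((m' : ℤ) - m : ℤ) : ℝ)
        = ((m : ℝ) - α * ((n : ℝ) + β)) - ((m' : ℝ) - α * ((n' : ℝ) + β)) := by
      rw [hQr]; push_cast; ring
    rw [this]
    calc |((m : ℝ) - α * ((n : ℝ) + β)) - ((m' : ℝ) - α * ((n' : ℝ) + β))|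
        ≤ |(m : ℝ) - α * ((n : ℝ) + β)| + |(m' : ℝ) - α * ((n' : ℝ) + β)| := abs_sub _ _
      _ ≤ C / n + C / n := add_le_add e1 e2'
      _ = 2 * C / n := by ring
  -- Liouville with `b + 1 = Q`
  have hL := hLiou ((m' : ℤ) - m) (Q - 1)
  have hQ' : ((Q - 1 : ℕ) : ℝ) + 1 = Q := by
    rw [Nat.cast_sub hQ1]; push_cast; ring
  rw [hQ'] at hL
  have hdiv : |α - (((m' : ℤ) - m : ℤ) : ℝ) / Q| ≤ 2 * C / n / Q := by
    rw [show α - (((m' : ℤ) - m : ℤ) : ℝ) / Q = (α * Q - (((m' : ℤ) - m : ℤ) : ℝ)) / Q by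
      field_simp]
    rw [abs_div, abs_of_pos hQpos]
    exact div_le_div_of_nonneg_right hαQ hQpos.le
  -- `1 ≤ Q^d · (2C/(nQ)) · A = Q^{d-1} · 2CA / n`
  have h1 : (1 : ℝ) ≤ (Q : ℝ) ^ d * (2 * C / n / Q * A) :=
    hL.trans (mul_le_mul_of_nonneg_left (mul_le_mul_of_nonneg_right hdiv hA0.le) (by positivity))
  have h2 : (Q : ℝ) ^ d * (2 * C / n / Q * A) = 2 * C * A * (Q : ℝ) ^ (d - 1) / n := by
    have : (Q : ℝ) ^ d = (Q : ℝ) ^ (d - 1) * Q := by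
      rw [← pow_succ]; congr 1; omega
    rw [this]
    field_simp
  rw [h2, le_div_iff₀ hnpos, one_mul] at h1
  rw [← hQr]
  exact h1

end Summit.Parity.BatemanHorn.Theorems
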